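import Mathlib
import Summits.CriticalPhenomena.CardyFormulaZ2.Theorems.CardyMagicRigidityNestingRigidityUVExpMomentsReduction
import HarnessLib

/-!
# Crux `NestingRigidity`, line `positive-cone-weight-doubling`: the inputs of [A]
# `uvExpMoments_latticeEnsembles` are CHARGE-FREE (only the product `a·t` of order and charge matters)

Crux `Summit.CriticalPhenomena.CardyFormulaZ2.Theses.CardyMagicRigidity.NestingRigidity`
(stmt-CriticalPhenomena-4835), line `positive-cone-weight-doubling`, registered helper [A]
`uvExpMoments_latticeEnsembles`.  By the bite formula `θ_u = t(φ_u − ψ_u)`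
(`ConeTilt.cone_nestingPhase_eq`) every additive statistic of the cone phases is the charge `t` times
a CHARGE-FREE loop statistic: `Σ_{u ∈ S} θ_u = t · Σ_{u ∈ S} (φ_u − ψ_u)` and
`Σ_{u ∈ S} θ_u² = t² · Σ_{u ∈ S} (φ_u − ψ_u)²` for EVERY loop family `S` (§1, `mul_finsum_mem`: no
finiteness needed).  Hence (§2, registered anchor `uvExpMoments_of_chargeFree_bounds`) the three
inputs (F), (F₂), (K) of `uvExpMoments_of_far_and_collar_bounds` (…UVExpMomentsReduction) reduce to
three charge-free all-order statements about the lattice loop ensemble alone: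

* (Ξ)  `E_δ exp(a (Ξ_F − E_δ Ξ_F)) ≤ C(a)` for every real `a`, `Ξ_F = Σ_{far} (φ_u − ψ_u)`;
* (Ξ₂) `E_δ exp(a Σ_{far} (φ_u − ψ_u)²) ≤ C(a)` for every `a > 0`;
* (K)  `E_δ exp(a K) ≤ C(a)` for every `a > 0` (collar statistic),

for all small `r` and then all small meshes — and [A] follows on both lattices.  In particular the
order `s` and the charge `t` enter [A] only through `s·t` (and `s·t²`): "all orders at one charge" is
the same input as "one order at all charges".  No cited fact, no definition.
-/

noncomputable section

open MeasureTheory ProbabilityTheory Set Filter Metric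
open scoped Real Topology BigOperators

namespace Summit.CriticalPhenomena.CardyFormulaZ2.Cruxes.NestingRigidity.PositiveConeWeightDoubling

open Literature.Probability.RandomPlanarGeometry Literature.Probability.Percolation
  Literature.Probability.LatticeModels
open Summit.CriticalPhenomena.CardyFormulaZ2.Cruxes.NestingRigidity.RingCloudTomography

namespace UVExpMoments

/-! ## §1 The cone phases are the charge times charge-free bites -/

/-- `Σ_{u ∈ S} θ_u = t · Σ_{u ∈ S} (φ_u − ψ_u)` for every loop family `S` (junk values included). -/
theorem finsum_cone_nestingPhase_eq (t r : ℝ) (S : Set (UnbasedLoop ℂ)) :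
    ∑ᶠ u ∈ S, u.nestingPhase (coneCloud t r).density =
      t * ∑ᶠ u ∈ S, ((∫ z in {z | u.wind z ≠ 0}, discDensity 0 r z) -
        ∫ z in {z | u.wind z ≠ 0}, annulusDensity 0 1 2 z) := by
  rw [mul_finsum_mem]
  exact finsum_mem_congr rfl fun u _ ↦ ConeTilt.cone_nestingPhase_eq (𝔠 := coneCloud t r) rfl u

/-- `Σ_{u ∈ S} θ_u² = t² · Σ_{u ∈ S} (φ_u − ψ_u)²` for every loop family `S`. -/
theorem finsum_cone_nestingPhase_sq_eq (t r : ℝ) (S : Set (UnbasedLoop ℂ)) :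
    ∑ᶠ u ∈ S, u.nestingPhase (coneCloud t r).density ^ 2 =
      t ^ 2 * ∑ᶠ u ∈ S, ((∫ z in {z | u.wind z ≠ 0}, discDensity 0 r z) -
        ∫ z in {z | u.wind z ≠ 0}, annulusDensity 0 1 2 z) ^ 2 := by
  rw [mul_finsum_mem]
  exact finsum_mem_congr rfl fun u _ ↦ by
    rw [ConeTilt.cone_nestingPhase_eq (𝔠 := coneCloud t r) rfl u]; ring

/-- The charge-free bite `φ_u − ψ_u` is bounded by `1` and vanishes where the unit-charge phase does. -/
theorem abs_bite_le_one {r : ℝ} (hr : 0 < r) (u : UnbasedLoop ℂ) :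
    |(∫ z in {z | u.wind z ≠ 0}, discDensity 0 r z) - ∫ z in {z | u.wind z ≠ 0}, annulusDensity 0 1 2 z| ≤ 1 := by
  have h₁ := ConeTilt.setIntegral_discDensity_mem_Icc 0 hr {z | u.wind z ≠ 0}
  have h₂ := ConeTilt.setIntegral_annulusDensity_mem_Icc 0 one_pos one_lt_two {z | u.wind z ≠ 0}
  exact abs_le.2 ⟨by linarith [h₁.1, h₂.2], by linarith [h₁.2, h₂.1]⟩

/-- The bite is the unit-charge phase. -/
theorem bite_eq_nestingPhase_one (r : ℝ) (u : UnbasedLoop ℂ) :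
    (∫ z in {z | u.wind z ≠ 0}, discDensity 0 r z) - ∫ z in {z | u.wind z ≠ 0}, annulusDensity 0 1 2 z =
      u.nestingPhase (coneCloud 1 r).density := by
  rw [ConeTilt.cone_nestingPhase_eq (𝔠 := coneCloud 1 r) rfl u, one_mul]

/-- **At a fixed mesh every charge-free bite statistic is uniformly bounded** (both lattices,
`0 < r ≤ 1`): `|Σ_{u ∈ X_δ(ω), Q u} (φ_u − ψ_u)| ≤ B(δ)` and `|Σ_{u ∈ X_δ(ω), Q u} (φ_u − ψ_u)²| ≤ B(δ)`
for all samples and all predicates `Q` (the bites vanish off the loops meeting `B̄(0, 2)`). -/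
theorem exists_abs_finsum_bite_le : ∀ E ∈ latticeEnsembles, ∀ {δ : ℝ}, 0 < δ → ∀ {r : ℝ}, 0 < r →
    r ≤ 1 → ∃ B : ℝ, ∀ (ω : E.Ω) (Q : UnbasedLoop ℂ → Prop),
      |∑ᶠ u ∈ {u ∈ (E.X δ ω).loops | Q u}, ((∫ z in {z | u.wind z ≠ 0}, discDensity 0 r z) -
          ∫ z in {z | u.wind z ≠ 0}, annulusDensity 0 1 2 z)| ≤ B ∧
      |∑ᶠ u ∈ {u ∈ (E.X δ ω).loops | Q u}, ((∫ z in {z | u.wind z ≠ 0}, discDensity 0 r z) -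
          ∫ z in {z | u.wind z ≠ 0}, annulusDensity 0 1 2 z) ^ 2| ≤ B := by
  intro E hE δ hδ r hr hr1
  obtain ⟨B₁, hB₁⟩ := TiltTransfer.exists_abs_finsum_sep_le E hE hδ 1 hr hr1 _ zero_le_one
    (abs_bite_le_one hr) fun u hu ↦ by rw [bite_eq_nestingPhase_one, hu]
  obtain ⟨B₂, hB₂⟩ := TiltTransfer.exists_abs_finsum_sep_le E hE hδ 1 hr hr1
    (fun u ↦ ((∫ z in {z | u.wind z ≠ 0}, discDensity 0 r z) -
      ∫ z in {z | u.wind z ≠ 0}, annulusDensity 0 1 2 z) ^ 2) zero_le_one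
    (fun u ↦ by
      rw [abs_pow]
      exact pow_le_one₀ (abs_nonneg _) (abs_bite_le_one hr u))
    fun u hu ↦ by rw [bite_eq_nestingPhase_one, hu]; ring
  exact ⟨max B₁ B₂, fun ω Q ↦ ⟨(hB₁ ω Q).trans (le_max_left _ _), (hB₂ ω Q).trans (le_max_right _ _)⟩⟩

end UVExpMoments

/-- **[A] `uvExpMoments_latticeEnsembles` from three CHARGE-FREE all-order inputs** (registered
helper, line `positive-cone-weight-doubling`; both lattices).  For `E ∈ latticeEnsembles`: IF, for
all small `r` and then all small meshes, with constants uniform in `r`,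
(Ξ) for every real `a` the CENTRED far bite statistic `Ξ_F = Σ_{u ∈ X_δ, trace u ∩ A* = ∅} (φ_u − ψ_u)`
(`A* = B̄(0, 1+2δ) ∖ B(0, r−2δ)`; `φ_u`, `ψ_u` the disc and ring fractions inside `int u`) has
`E_δ exp(a(Ξ_F − E_δ Ξ_F)) ≤ C`, (Ξ₂) for every `a > 0`, `E_δ exp(a Σ_{far} (φ_u − ψ_u)²) ≤ C`, and
(K) for every `a > 0` the collar statistic has `E_δ exp(a K) ≤ C` — THEN [A] holds verbatim for
every charge `t` in the cone and every order `s > 0` (`θ_u = t(φ_u − ψ_u)`: input (F) of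
`uvExpMoments_of_far_and_collar_bounds` at `(t, a)` is (Ξ) at `a·t`, input (F₂) at `(t, a)` follows
from (Ξ₂) at `a(t² + 1)`). -/
theorem uvExpMoments_of_chargeFree_bounds : ∀ E ∈ latticeEnsembles,
    (∀ a : ℝ, ∃ C r₀ : ℝ, 0 < r₀ ∧ ∀ r ∈ Set.Ioo (0 : ℝ) r₀, ∀ᶠ δ in 𝓝[>] (0 : ℝ),
      ∫ ω, Real.exp (a * ((∑ᶠ u ∈ {u ∈ (E.X δ ω).loops |
          Disjoint u.range (Metric.closedBall (0 : ℂ) (1 + 2 * δ) \ Metric.ball 0 (r - 2 * δ))},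
          ((∫ z in {z | u.wind z ≠ 0}, discDensity 0 r z) - ∫ z in {z | u.wind z ≠ 0}, annulusDensity 0 1 2 z)) -
        ∫ ω', (∑ᶠ u ∈ {u ∈ (E.X δ ω').loops |
          Disjoint u.range (Metric.closedBall (0 : ℂ) (1 + 2 * δ) \ Metric.ball 0 (r - 2 * δ))},
          ((∫ z in {z | u.wind z ≠ 0}, discDensity 0 r z) - ∫ z in {z | u.wind z ≠ 0}, annulusDensity 0 1 2 z))
          ∂E.P)) ∂E.P ≤ C) →
    (∀ a : ℝ, 0 < a → ∃ C r₀ : ℝ, 0 < r₀ ∧ ∀ r ∈ Set.Ioo (0 : ℝ) r₀, ∀ᶠ δ in 𝓝[>] (0 : ℝ),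
      ∫ ω, Real.exp (a * ∑ᶠ u ∈ {u ∈ (E.X δ ω).loops |
          Disjoint u.range (Metric.closedBall (0 : ℂ) (1 + 2 * δ) \ Metric.ball 0 (r - 2 * δ))},
          ((∫ z in {z | u.wind z ≠ 0}, discDensity 0 r z) -
            ∫ z in {z | u.wind z ≠ 0}, annulusDensity 0 1 2 z) ^ 2) ∂E.P ≤ C) →
    (∀ a : ℝ, 0 < a → ∃ C r₀ : ℝ, 0 < r₀ ∧ ∀ r ∈ Set.Ioo (0 : ℝ) r₀, ∀ᶠ δ in 𝓝[>] (0 : ℝ),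
      ∫ ω, Real.exp (a * ((∑ᶠ u ∈ {u ∈ (E.X δ ω).loops |
            (u.range ∩ Metric.closedBall (0 : ℂ) r).Nonempty ∧ ¬ u.range ⊆ Metric.ball (0 : ℂ) (r - 2 * δ)},
            ∫ z in {z | u.wind z ≠ 0}, discDensity 0 r z) +
        ({u ∈ (E.X δ ω).loops | Metric.closedBall (0 : ℂ) r ⊆ {z | u.wind z ≠ 0} ∧
            ¬ u.range ⊆ Metric.ball (0 : ℂ) 1 ∧
            (u.range ∩ Metric.closedBall (0 : ℂ) (1 + 2 * δ)).Nonempty}.ncard : ℝ) +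
        ∑ᶠ u ∈ {u ∈ (E.X δ ω).loops | (u.range ∩ Metric.closedBall (0 : ℂ) (1 + 2 * δ)).Nonempty ∧
            ¬ u.range ⊆ Metric.ball (0 : ℂ) 1}, ∫ z in {z | u.wind z ≠ 0}, annulusDensity 0 1 2 z)) ∂E.P ≤ C) →
    ∀ t ∈ Set.Ioo (-(π / 6)) (π / 6), ∀ s : ℝ, 0 < s → ∃ C r₀ : ℝ, 0 < r₀ ∧ ∀ r ∈ Set.Ioo (0 : ℝ) r₀,
      ∀ᶠ δ in 𝓝[>] (0 : ℝ), ∀ Θ Θ₂ : E.Ω → ℝ,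
        (∀ ω, Θ ω = ∑ᶠ u ∈ (E.X δ ω).loops \ {u ∈ (E.X δ ω).loops |
            Metric.closedBall (0 : ℂ) r ⊆ {z | u.wind z ≠ 0} ∧ u.range ⊆ Metric.ball (0 : ℂ) 1},
            u.nestingPhase (coneCloud t r).density) →
        (∀ ω, Θ₂ ω = ∑ᶠ u ∈ (E.X δ ω).loops \ {u ∈ (E.X δ ω).loops |
            Metric.closedBall (0 : ℂ) r ⊆ {z | u.wind z ≠ 0} ∧ u.range ⊆ Metric.ball (0 : ℂ) 1},
            u.nestingPhase (coneCloud t r).density ^ 2) →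
        Integrable (fun ω ↦ Real.exp (s * (Θ ω + t * meanTower E δ r))) E.P ∧
        ∫ ω, Real.exp (s * (Θ ω + t * meanTower E δ r)) ∂E.P ≤ C ∧
        Integrable (fun ω ↦ Real.exp (-(s * (Θ ω + t * meanTower E δ r)))) E.P ∧
        ∫ ω, Real.exp (-(s * (Θ ω + t * meanTower E δ r))) ∂E.P ≤ C ∧
        Integrable (fun ω ↦ Real.exp (s * Θ₂ ω)) E.P ∧
        ∫ ω, Real.exp (s * Θ₂ ω) ∂E.P ≤ C := by
  intro E hE hΞ hΞ2 hK
  refine uvExpMoments_of_far_and_collar_bounds E hE (fun t _ a ↦ ?_) (fun t _ a ha ↦ ?_) hK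
  · -- (F) at `(t, a)` is (Ξ) at `a t`
    obtain ⟨C, r₀, hr₀, h⟩ := hΞ (a * t)
    refine ⟨C, r₀, hr₀, fun r hr ↦ ?_⟩
    refine (h r hr).mono fun δ hδC ↦ ?_
    set Ξ : E.Ω → ℝ := fun ω ↦ ∑ᶠ u ∈ {u ∈ (E.X δ ω).loops |
        Disjoint u.range (closedBall (0 : ℂ) (1 + 2 * δ) \ ball 0 (r - 2 * δ))},
        ((∫ z in {z | u.wind z ≠ 0}, discDensity 0 r z) -
          ∫ z in {z | u.wind z ≠ 0}, annulusDensity 0 1 2 z) with hΞdef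
    have e : ∀ ω, (∑ᶠ u ∈ {u ∈ (E.X δ ω).loops |
        Disjoint u.range (closedBall (0 : ℂ) (1 + 2 * δ) \ ball 0 (r - 2 * δ))},
        u.nestingPhase (coneCloud t r).density) = t * Ξ ω := fun ω ↦
      UVExpMoments.finsum_cone_nestingPhase_eq t r _
    have hm : ∫ ω, (∑ᶠ u ∈ {u ∈ (E.X δ ω).loops |
        Disjoint u.range (closedBall (0 : ℂ) (1 + 2 * δ) \ ball 0 (r - 2 * δ))},
        u.nestingPhase (coneCloud t r).density) ∂E.P = t * ∫ ω, Ξ ω ∂E.P := by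
      rw [← integral_const_mul]
      exact integral_congr_ae (Eventually.of_forall e)
    have hδC' : ∫ ω, Real.exp (a * t * (Ξ ω - ∫ ω', Ξ ω' ∂E.P)) ∂E.P ≤ C := hδC
    refine le_trans (le_of_eq (integral_congr_ae (Eventually.of_forall fun ω ↦ ?_))) hδC'
    beta_reduce
    rw [e ω, hm]
    congr 1
    ring
  · -- (F₂) at `(t, a)` from (Ξ₂) at `a (t² + 1)`
    obtain ⟨C, r₀, hr₀, h⟩ := hΞ2 (a * (t ^ 2 + 1)) (by positivity)
    refine ⟨C, min r₀ 1, lt_min hr₀ one_pos, fun r hr ↦ ?_⟩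
    have hr1 : r ≤ 1 := (hr.2.trans_le (min_le_right _ _)).le
    refine ((h r ⟨hr.1, hr.2.trans_le (min_le_left _ _)⟩).and self_mem_nhdsWithin).mono fun δ hδ' ↦ ?_
    obtain ⟨hδC, hδ⟩ := hδ'
    replace hδ : 0 < δ := hδ
    obtain ⟨B, hB⟩ := UVExpMoments.exists_abs_finsum_bite_le E hE hδ hr.1 hr1
    set q : E.Ω → ℝ := fun ω ↦ ∑ᶠ u ∈ {u ∈ (E.X δ ω).loops |
        Disjoint u.range (closedBall (0 : ℂ) (1 + 2 * δ) \ ball 0 (r - 2 * δ))},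
        ((∫ z in {z | u.wind z ≠ 0}, discDensity 0 r z) -
          ∫ z in {z | u.wind z ≠ 0}, annulusDensity 0 1 2 z) ^ 2 with hq
    have hq0 : ∀ ω, 0 ≤ q ω := fun ω ↦ finsum_nonneg fun u ↦ finsum_nonneg fun _ ↦ sq_nonneg _
    have hqm : Measurable q := FirstMoment.measurable_finsum_loops_sep E hE δ _ _
    have hqb : ∀ ω, |q ω| ≤ B := fun ω ↦ (hB ω _).2
    have hint := UVExpMoments.integrable_exp_of_abs_le E hE q (a * (t ^ 2 + 1)) B hqm hqb
    have hδC' : ∫ ω, Real.exp (a * (t ^ 2 + 1) * q ω) ∂E.P ≤ C := hδC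
    have e : ∀ ω, (∑ᶠ u ∈ {u ∈ (E.X δ ω).loops |
        Disjoint u.range (closedBall (0 : ℂ) (1 + 2 * δ) \ ball 0 (r - 2 * δ))},
        u.nestingPhase (coneCloud t r).density ^ 2) = t ^ 2 * q ω := fun ω ↦
      UVExpMoments.finsum_cone_nestingPhase_sq_eq t r _
    calc ∫ ω, Real.exp (a * ∑ᶠ u ∈ {u ∈ (E.X δ ω).loops |
          Disjoint u.range (closedBall (0 : ℂ) (1 + 2 * δ) \ ball 0 (r - 2 * δ))},
          u.nestingPhase (coneCloud t r).density ^ 2) ∂E.P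
        ≤ ∫ ω, Real.exp (a * (t ^ 2 + 1) * q ω) ∂E.P :=
          integral_mono_of_nonneg (Eventually.of_forall fun ω ↦ (Real.exp_pos _).le) hint
            (Eventually.of_forall fun ω ↦ Real.exp_le_exp.2 (by
              rw [e ω]; nlinarith [hq0 ω, ha.le]))
      _ ≤ C := hδC'


end Summit.CriticalPhenomena.CardyFormulaZ2.Cruxes.NestingRigidity.PositiveConeWeightDoubling

end
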